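import Summits.NavierStokesRegularity.FunctionalMining.TopEigLaminateRigid
import HarnessLib

/-!
# FunctionalMining — laminates lie in every top-gap class `λ₂ ≤ (1 − η)λ₁` (`λ₂ ≡ 0`), so the laminate
# rigidity of L-λ(2) is a statement INSIDE the dictionary's Proposition L-λ(η) classes (bookkeeping)

Search for candidate a priori estimates; no regularity claim. Cell `pub-nsfunc`, prove seat
(gen 19). Bookkeeping between `TopEigLaminateRigid` (every laminate `u = A(k·x)`, `k ≠ 0`,
`k·A′ ≡ 0`, has `8π²|k|²·∫(λ₁⁺)²(u) ≤ heatDissipation (∫(λ₁⁺)²) u`) and the dictionary's typed classes of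
`TopEigHeatCoerciveGap.lean`:

* `midEig_lamV` — the middle strain eigenvalue of a laminate vanishes identically (`λ₂(S(u)) ≡ 0`: the
  strain is the plane shear `sym(A′(k·x)⊗k)` with eigenvalues `±½|A′||k|, 0`; `TopEig.lam_shearT`);
* `isLaminate_strainGapClass` — hence `IsLaminate v → StrainGapClass η v` for every `η ≤ 1`: the laminate
  class sits inside every top-gap class of Proposition L-λ(η), in particular inside `λ₂ ≤ 0` (Sieve K's
  class `𝒵`);
* `heatCoerciveOn_isLaminate_gap_two` — the rigidity restated on the intersections:
  `HeatCoerciveOn (fun v => IsLaminate v ∧ StrainGapClass η v) (∫(λ₁⁺)²) (8π²)` (trivially from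
  `heatCoerciveOn_isLaminate_two`), recorded so that the dictionary can quote ONE class predicate.
Nothing about Navier–Stokes dynamics is asserted. [ours, bookkeeping]
-/

noncomputable section

open MeasureTheory Set

namespace Summit.NavierStokesRegularity.FunctionalMining

open Literature.Analysis Literature.Analysis.FunctionSpaces Literature.Analysis.FunctionSpaces.Torus
open TopEig StrainL4 LaminateDirection

namespace TopEigLaminate

/-- **`λ₂(S(u)) ≡ 0` for every laminate** `u = A(k·x)` with `k·A′ ≡ 0`. [ours] -/
theorem midEig_lamV {k : Fin 3 → ℤ} {A : Fin 3 → ShearProfile}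
    (hdiv : ∀ s : ℝ, ∑ i, (k i : ℝ) * (A i).D s = 0) (x : UnitAddTorus (Fin 3)) :
    torusStrainMidEig (lamV k A) x = 0 := by
  have hS : strainFlat (lamV k A) x = shearT (aVec (k := k) A x) (kR k) := strainFlat_lamV A x
  have hak : aVec (k := k) A x ⬝ᵥ kR k = 0 := by
    have h := aVec_line_dot hdiv 0 x
    simpa using h
  have hnak : (-aVec (k := k) A x) ⬝ᵥ kR k = 0 := by rw [neg_dotProduct, hak, neg_zero]
  have htop : torusStrainTopEig (lamV k A) x = lam (strainFlat (lamV k A) x) := (lam_strainFlat _ x).symm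
  have hbot : torusStrainBotEig (lamV k A) x = -lam (-strainFlat (lamV k A) x) := by
    have h := lam_neg_strainFlat (lamV k A) x
    linarith
  have h1 : lam (strainFlat (lamV k A) x) = Real.sqrt ((aVec (k := k) A x ⬝ᵥ aVec (k := k) A x) *
      (kR k ⬝ᵥ kR k)) / 2 := by rw [hS, lam_shearT hak]
  have h2 : lam (-strainFlat (lamV k A) x) = Real.sqrt ((aVec (k := k) A x ⬝ᵥ aVec (k := k) A x) *
      (kR k ⬝ᵥ kR k)) / 2 := by
    rw [hS, neg_shearT, lam_shearT hnak]
    simp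
  unfold torusStrainMidEig
  rw [sum_torusStrainEig_eq_zero (isSmooth_lamV k A) (isDivFree_lamV hdiv), htop, hbot, h1, h2]
  ring

/-- **Laminates lie in every top-gap class**: `IsLaminate v → StrainGapClass η v` (`η ≤ 1`). [ours] -/
theorem isLaminate_strainGapClass {v : UnitAddTorus (Fin 3) → EuclideanSpace ℝ (Fin 3)}
    (hv : IsLaminate v) {η : ℝ} (hη : η ≤ 1) : StrainGapClass η v := by
  obtain ⟨k, A, hk, hdiv, rfl⟩ := hv
  intro x
  rw [midEig_lamV hdiv]
  exact mul_nonneg (by linarith)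
    (torusStrainTopEig_nonneg (by simp) (isSmooth_lamV k A) (isDivFree_lamV hdiv) x)

/-- The laminate rigidity of L-λ(2) restated on the intersection with any top-gap class:
`HeatCoerciveOn (IsLaminate ∧ StrainGapClass η) (∫(λ₁⁺)²) (8π²)`. [ours, bookkeeping] -/
theorem heatCoerciveOn_isLaminate_gap_two (η : ℝ) :
    HeatCoerciveOn (d := Fin 3) (fun v => IsLaminate v ∧ StrainGapClass η v) (torusTopEigMoment 2)
      (8 * Real.pi ^ 2) :=
  heatCoerciveOn_isLaminate_two.of_imp fun _ _ _ _ _ h => h.1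

end TopEigLaminate

end Summit.NavierStokesRegularity.FunctionalMining

end
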